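import Summits.QuantumFields.YangMills.Theses.ThermodynamicCeilings
import Summits.QuantumFields.YangMills.Theorems.SquareRootCeilingsMirrorDominationRPCS
import Summits.QuantumFields.YangMills.Theorems.BalabanLadderNTMirrorHankelTorus
import HarnessLib

/-!
# Route `ThermodynamicCeilings`, support `MirrorMonotoneDecay` (stmt-QuantumFields-27771) — PROVED from the two reflection
# positivities of the odd torus (mirror-Hankel log-convexity), without transfer matrices

For every compact group `G`, every lattice representation `r`, every `β ≥ 0`, every odd torus `(ℤ/(2L+1))⁴`, every plane
`q = (q.1 < q.2)`, every axis `k` and `2 ≤ t`, `t + 1 ≤ L`, the centred on-axis plaquette–plaquette covariance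
`c_L(t) = Cov_T(P_q(t e_k), P_q(0))` satisfies `0 ≤ c_L(t+1) ≤ c_L(t)`.

Proof (Osterwalder–Seiler, no spectral theory): (1) a coordinate permutation moves the axis `k` to the time axis `0`
(`MirrorDomination.cov_coordPerm`); (2) on the time axis `c_L(n)` is — up to the one-unit shift of a temporal plaquette under the
site reflection — the MIRROR SEQUENCE `n ↦ Cov_T(P∘ϑ, τ_n P)` of the plane field lifted to the torus
(`MirrorHankel.mirrorSeq_torusLift`, `InfVolRP.plane_cfgReflect`); (3) site- AND link-reflection positivity of Wilson's measure on
the odd torus make that sequence non-negative and log-convex in the lag while the translate stays in the non-negative half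
(`MirrorHankel.mirrorSeq_nonneg`, `MirrorHankel.mirrorSeq_logConvex` — both parities, i.e. positivity of the transfer matrix itself,
not only of its square); (4) torus symmetry `c_L(s) = c_L(2L+1−s)` pins `c_L(L) = c_L(L+1)`, and a non-negative log-convex sequence
with two equal consecutive entries is non-increasing below them (elementary downward induction `c(n+1)² ≤ c(n)c(n+2) ≤ c(n)c(n+1)`).

Free-hands width seat `ym-t4-w11` (cell ym-fleet) for planner ym-idea-11 (LINE E; critic idea-crit-9 #35/#35c).  THEOREMS ONLY
(no `def`, no `sorry`).  This closes a SUPPORT item of a leaf line; no summit / leaf / NT / mass-gap statement is proved.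

References: K. Osterwalder, E. Seiler, Ann. Phys. **110** (1978) 440, §2 [OsterwalderSeiler1978]; J. Fröhlich, R. Israel, E. Lieb,
B. Simon, Commun. Math. Phys. **62** (1978) 1, Thm. 2.1 [FILS1978]; M. Lüscher, Commun. Math. Phys. **54** (1977) 283 [Luscher1977];
J. Glimm, A. Jaffe, *Quantum Physics* (1987) §6.1 [GlimmJaffe1987].
-/

set_option autoImplicit false

noncomputable section

open MeasureTheory Filter Topology
open Literature.MathematicalPhysics.QuantumFieldTheory Literature.MathematicalPhysics.QuantumLattice
open Literature.Probability.LatticeModels (Site)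
open Summit.QuantumFields.YangMills.Cruxes.OSLegsFromFemtoAndGap.DlrCollarTransfer
open Summit.QuantumFields.YangMills.Theorems.OSLegsFromFemtoAndGap (permPlane permPlane_valid)
open Summit.QuantumFields.YangMills.Theorems.InfVolRP (reflSite reflSite_apply_zero reflSite_apply_of_ne plane_cfgReflect)
open Summit.QuantumFields.YangMills.Theorems.MirrorDomination
  (torusE_plane_site cov_translate cov_symm cov_add_period cov_eq_sub cov_coordPerm)
open Summit.QuantumFields.YangMills.Cruxes.NT.MirrorHankel
  (slab mirrorSeq mirrorSeq_nonneg mirrorSeq_logConvex mirrorSeq_torusLift latticeConnectedCorr_eq_torusCov)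
open Summit.QuantumFields.YangMills.Cruxes.NT.MarkovMirror (dependsOn_comp_torusLift)

namespace Summit.QuantumFields.YangMills.Theorems.MirrorMonotoneDecay

/-! ## §1 The elementary step: a non-negative log-convex sequence with equal top entries is non-increasing below them -/

/-- **Downward induction on a log-convex sequence.**  If `a` is non-negative on `[0, M+1]`, log-convex
(`a(n+1)² ≤ a(n)·a(n+2)`) for `n + 1 ≤ M`, and `a(M+1) ≤ a(M)`, then `a(t+1) ≤ a(t)` for every `t ≤ M`. [folklore] -/
theorem step_le_of_logConvex (a : ℕ → ℝ) (M : ℕ) (hnn : ∀ n, n ≤ M + 1 → 0 ≤ a n)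
    (hlc : ∀ n, n + 1 ≤ M → a (n + 1) ^ 2 ≤ a n * a (n + 2)) (htop : a (M + 1) ≤ a M) :
    ∀ t, t ≤ M → a (t + 1) ≤ a t := by
  -- induct on the distance `d = M - t` to the top
  suffices h : ∀ d t : ℕ, t + d = M → a (t + 1) ≤ a t by
    intro t ht
    exact h (M - t) t (by omega)
  intro d
  induction d with
  | zero => intro t ht; rw [Nat.add_zero] at ht; subst ht; exact htop
  | succ d ih =>
    intro t ht
    have hnext : a (t + 1 + 1) ≤ a (t + 1) := ih (t + 1) (by omega)
    have h2 : a (t + 2) ≤ a (t + 1) := by simpa only [add_assoc] using hnext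
    have hc := hlc t (by omega)
    have h0 : 0 ≤ a t := hnn t (by omega)
    have h1 : 0 ≤ a (t + 1) := hnn (t + 1) (by omega)
    have hprod : a (t + 1) ^ 2 ≤ a t * a (t + 1) := hc.trans (mul_le_mul_of_nonneg_left h2 h0)
    by_contra hlt
    have hlt : a t < a (t + 1) := not_le.mp hlt
    have hpos : 0 < a (t + 1) := lt_of_le_of_lt h0 hlt
    have : a (t + 1) * a (t + 1) ≤ a t * a (t + 1) := by simpa only [sq] using hprod
    have := le_of_mul_le_mul_right this hpos
    exact absurd this (not_le.mpr hlt)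

/-! ## §2 The plane field at the origin, lifted to the odd torus, lives in the slab `0 ≤ t ≤ 1` -/

variable (G : Type) [Group G] [TopologicalSpace G] [IsTopologicalGroup G] [CompactSpace G]
  [MeasurableSpace G] [BorelSpace G] (r : LatticeRep G)

omit [IsTopologicalGroup G] [CompactSpace G] [BorelSpace G] [TopologicalSpace G] [MeasurableSpace G] [Group G] in
/-- A link of `ℤ⁴` in a SPATIAL direction based at a time `t ∈ [0, T]` projects, on the torus of side `2L+1` with `T ≤ 2L`, to
a link of the slab `0 ≤ t ≤ T` (both endpoints at time `t`). [folklore] -/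
theorem torusEdge_mem_slab_of_ne_zero (L T : ℕ) (hT : T ≤ 2 * L) {e : Literature.MathematicalPhysics.QuantumLattice.ZdEdge 4}
    (hi : e.2 ≠ 0) (h0 : 0 ≤ e.1 0) (h1 : e.1 0 ≤ T) :
    torusEdge (2 * L + 1) e ∈ slab (d := 4) (L := 2 * L + 1) 0 T := by
  obtain ⟨x, i⟩ := e
  simp only at h0 h1 hi
  obtain ⟨t, ht⟩ := Int.eq_ofNat_of_zero_le h0
  have htT : t ≤ T := by omega
  have hlt : t < 2 * L + 1 := by omega
  have hval : ((Literature.Probability.LatticeModels.Torus.proj (2 * L + 1) x) 0).val = t := by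
    simp only [Literature.Probability.LatticeModels.Torus.proj_apply, ht, Int.cast_natCast, ZMod.val_natCast,
      Nat.mod_eq_of_lt hlt]
  refine ⟨Nat.zero_le _, by simp only [torusEdge]; rw [hval]; exact htT, ?_⟩
  simp only [torusEdge]
  rw [WilsonRP.shift_apply_of_ne _ (fun h => hi h.symm), hval]
  exact htT

omit [IsTopologicalGroup G] [CompactSpace G] [BorelSpace G] in
/-- **The lifted plane field at the origin is an observable of the slab `0 ≤ t ≤ 1`** of every odd torus `2L+1 ≥ 3`
(`q.1 < q.2`: the four links of the plaquette have both endpoints at times in `{0, 1}` — temporal links only when `q.1 = 0`).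
[folklore] -/
theorem dependsOn_slab_plane_zero {L : ℕ} (hL : 1 ≤ L) {q : Fin 4 × Fin 4} (hq : q.1 < q.2) :
    DependsOn (fun U : GaugeConfig 4 (2 * L + 1) G => plane G r q 0 (torusLift (2 * L + 1) U))
      (slab (d := 4) (L := 2 * L + 1) 0 1) := by
  classical
  refine (dependsOn_comp_torusLift (2 * L + 1) (isCylinder_plane (G := G) r q 0)).mono fun e he => ?_
  obtain ⟨e', he', rfl⟩ := Finset.mem_image.1 (Finset.mem_coe.1 he)
  have hj : q.2 ≠ 0 := fun h => by rw [h] at hq; exact (Fin.not_lt_zero _) hq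
  -- the four links of the origin plaquette, translated by `0`
  obtain ⟨e'', he'', rfl⟩ := Finset.mem_image.1 he'
  simp only [originPlaquetteSupport, Finset.mem_insert, Finset.mem_singleton] at he''
  by_cases hdir : e''.2 = 0
  · -- a temporal link: based at time `0` (only `(0, q.1)` with `q.1 = 0` or `(e_{q.2}, q.1)` with `q.1 = 0`)
    refine Cruxes.NT.MirrorHankel.torusEdge_mem_slab L 1 (by omega) ?_ ?_
    · rcases he'' with rfl | rfl | rfl | rfl <;> simp [Pi.single_apply] <;> split_ifs <;> simp
    · rcases he'' with rfl | rfl | rfl | rfl <;> simp_all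
  · refine torusEdge_mem_slab_of_ne_zero L 1 (by omega) (by simpa using hdir) ?_ ?_
    · rcases he'' with rfl | rfl | rfl | rfl <;> simp [Pi.single_apply] <;> split_ifs <;> simp
    · rcases he'' with rfl | rfl | rfl | rfl <;> simp [Pi.single_apply] <;> split_ifs <;> simp

/-! ## §3 The mirror sequence of the lifted plane field is the centred on-axis covariance -/

omit [IsTopologicalGroup G] [CompactSpace G] [BorelSpace G] [TopologicalSpace G] [MeasurableSpace G] [Group G] in
/-- The base site of the reflected origin plaquette of a MAGNETIC plane (`q.1 ≠ 0`) is the origin. [folklore] -/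
theorem reflSite_zero_of_ne {q : Fin 4 × Fin 4} (hq : q.1 ≠ 0) : reflSite q (0 : Site 4) = 0 := by
  ext k
  by_cases hk : k = 0
  · subst hk; rw [reflSite_apply_zero]; simp [hq]
  · rw [reflSite_apply_of_ne q 0 hk]

omit [IsTopologicalGroup G] [CompactSpace G] [BorelSpace G] [TopologicalSpace G] [MeasurableSpace G] [Group G] in
/-- The base site of the reflected origin plaquette of an ELECTRIC plane (`q.1 = 0`) is `−e₀`. [folklore] -/
theorem reflSite_zero_of_eq {q : Fin 4 × Fin 4} (hq : q.1 = 0) : reflSite q (0 : Site 4) = -Pi.single 0 1 := by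
  ext k
  by_cases hk : k = 0
  · subst hk; rw [reflSite_apply_zero]; simp [hq]
  · rw [reflSite_apply_of_ne q 0 hk]; simp [hk]

/-- **The mirror sequence of the lifted plane field, in the route's letters**: for `q.1 < q.2`,
`q_{P_q(0)∘lift}(n) = Cov_T(P_q(reflSite q 0), P_q(n e₀))` (centred two-point function of the tree's `MirrorDomination` toolkit).
[cite: OsterwalderSeiler1978, §2] -/
theorem mirrorSeq_plane_eq_cov (β : ℝ) (L : ℕ) {q : Fin 4 × Fin 4} (hq : q.1 < q.2) (n : ℕ) :
    mirrorSeq r.ρ β (fun U : GaugeConfig 4 (2 * L + 1) G => plane G r q 0 (torusLift (2 * L + 1) U)) n =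
      torusE G r β L (fun U => (plane G r q (reflSite q 0) U - torusE G r β L (plane G r q (reflSite q 0))) *
        (plane G r q (Pi.single 0 (n : ℤ)) U - torusE G r β L (plane G r q (Pi.single 0 (n : ℤ))))) := by
  rw [mirrorSeq_torusLift G r β L (plane G r q 0) n, latticeConnectedCorr_eq_torusCov G r β L (plane G r q 0) n,
    cov_eq_sub G r β L q q (reflSite q 0) (Pi.single 0 (n : ℤ))]
  have hshift : ∀ V : LGConfig 4 G, plane G r q 0 (configShift (-(Pi.single 0 (n : ℤ))) V) =
      plane G r q (Pi.single 0 (n : ℤ)) V := fun V => by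
    rw [← InfiniteVolume.plane_add r q 0 (Pi.single 0 (n : ℤ)) V, zero_add]
  simp only [plane_cfgReflect r hq, hshift]
  rw [torusE_plane_site G r β L q 0 (Pi.single 0 (n : ℤ))]

/-- **Magnetic planes** (`0 < q.1 < q.2`): `q_{P∘lift}(n) = c(n) := Cov_T(P_q(n e₀), P_q(0))`. [cite: OsterwalderSeiler1978, §2] -/
theorem mirrorSeq_plane_eq_of_ne (β : ℝ) (L : ℕ) {q : Fin 4 × Fin 4} (hq : q.1 < q.2) (hq0 : q.1 ≠ 0) (n : ℕ) :
    mirrorSeq r.ρ β (fun U : GaugeConfig 4 (2 * L + 1) G => plane G r q 0 (torusLift (2 * L + 1) U)) n =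
      torusE G r β L (fun U => (plane G r q (Pi.single 0 (n : ℤ)) U - torusE G r β L (plane G r q (Pi.single 0 (n : ℤ)))) *
        (plane G r q 0 U - torusE G r β L (plane G r q 0))) := by
  rw [mirrorSeq_plane_eq_cov G r β L hq n, reflSite_zero_of_ne hq0, cov_symm]

/-- **Electric planes** (`q.1 = 0`): `q_{P∘lift}(n) = c(n+1)` (the reflected temporal plaquette hangs one unit below the mirror).
[cite: OsterwalderSeiler1978, §2] -/
theorem mirrorSeq_plane_eq_of_eq (β : ℝ) (L : ℕ) {q : Fin 4 × Fin 4} (hq : q.1 < q.2) (hq0 : q.1 = 0) (n : ℕ) :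
    mirrorSeq r.ρ β (fun U : GaugeConfig 4 (2 * L + 1) G => plane G r q 0 (torusLift (2 * L + 1) U)) n =
      torusE G r β L (fun U => (plane G r q (Pi.single 0 ((n + 1 : ℕ) : ℤ)) U -
          torusE G r β L (plane G r q (Pi.single 0 ((n + 1 : ℕ) : ℤ)))) *
        (plane G r q 0 U - torusE G r β L (plane G r q 0))) := by
  rw [mirrorSeq_plane_eq_cov G r β L hq n, reflSite_zero_of_eq hq0]
  have h := cov_translate G r β L q q (-Pi.single 0 1) (Pi.single 0 (n : ℤ)) (Pi.single 0 1)
  have h1 : (-Pi.single 0 1 : Site 4) + Pi.single 0 1 = 0 := by simp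
  have h2 : (Pi.single 0 (n : ℤ) : Site 4) + Pi.single 0 1 = Pi.single 0 ((n + 1 : ℕ) : ℤ) := by
    rw [← Pi.single_add]; push_cast; rfl
  rw [h1, h2] at h
  rw [← h, cov_symm]

/-! ## §4 Torus symmetry of the on-axis covariance: `c(s) = c(2L+1−s)` -/

/-- **Mirror symmetry of the on-axis covariance on the torus**: `Cov_T(P_q(s e₀), P_q(0)) = Cov_T(P_q((2L+1−s) e₀), P_q(0))` for
`s ≤ 2L+1` (translation invariance, symmetry and periodicity of the torus two-point function). [folklore] -/
theorem cov_axis_symm (β : ℝ) (L : ℕ) (q : Fin 4 × Fin 4) {s : ℕ} (hs : s ≤ 2 * L + 1) :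
    torusE G r β L (fun U => (plane G r q (Pi.single 0 (s : ℤ)) U - torusE G r β L (plane G r q (Pi.single 0 (s : ℤ)))) *
        (plane G r q 0 U - torusE G r β L (plane G r q 0))) =
      torusE G r β L (fun U => (plane G r q (Pi.single 0 ((2 * L + 1 - s : ℕ) : ℤ)) U -
          torusE G r β L (plane G r q (Pi.single 0 ((2 * L + 1 - s : ℕ) : ℤ)))) *
        (plane G r q 0 U - torusE G r β L (plane G r q 0))) := by
  -- translate by `−s e₀`, wind once around the torus, and use symmetry
  have h := cov_translate G r β L q q 0 (-Pi.single 0 (s : ℤ)) (Pi.single 0 (s : ℤ))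
  simp only [zero_add, neg_add_cancel] at h
  rw [h]
  have hp := cov_add_period G r β L q q 0 (-Pi.single 0 (s : ℤ)) (Pi.single 0 1)
  have hvec : (-Pi.single 0 (s : ℤ) : Site 4) + ((2 * L + 1 : ℕ) : ℤ) • Pi.single 0 1 =
      Pi.single 0 ((2 * L + 1 - s : ℕ) : ℤ) := by
    ext k
    by_cases hk : k = 0
    · subst hk; simp; push_cast [Nat.cast_sub hs]; ring
    · simp [hk]
  rw [hvec] at hp
  rw [← hp, cov_symm]

/-! ## §5 The time axis -/

/-- **Monotone decay of the mirror covariance along the time axis.**  For `β ≥ 0`, the odd torus `2L+1`, a plane `q.1 < q.2`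
and `2 ≤ t`, `t + 1 ≤ L`: `0 ≤ c(t+1) ≤ c(t)` where `c(s) = Cov_T(P_q(s e₀), P_q(0))`.
[cite: OsterwalderSeiler1978, §2; FILS1978, Thm. 2.1] -/
theorem mirrorMonotoneDecay_axis0 {β : ℝ} (hβ : 0 ≤ β) {L : ℕ} {q : Fin 4 × Fin 4} (hq : q.1 < q.2) {t : ℕ}
    (ht : 2 ≤ t) (htL : t + 1 ≤ L) :
    0 ≤ torusE G r β L (fun U => (plane G r q (Pi.single 0 ((t + 1 : ℕ) : ℤ)) U -
            torusE G r β L (plane G r q (Pi.single 0 ((t + 1 : ℕ) : ℤ)))) *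
          (plane G r q 0 U - torusE G r β L (plane G r q 0))) ∧
      torusE G r β L (fun U => (plane G r q (Pi.single 0 ((t + 1 : ℕ) : ℤ)) U -
            torusE G r β L (plane G r q (Pi.single 0 ((t + 1 : ℕ) : ℤ)))) *
          (plane G r q 0 U - torusE G r β L (plane G r q 0))) ≤
        torusE G r β L (fun U => (plane G r q (Pi.single 0 (t : ℤ)) U - torusE G r β L (plane G r q (Pi.single 0 (t : ℤ)))) *
          (plane G r q 0 U - torusE G r β L (plane G r q 0))) := by
  haveI := r.secondCountableTopology
  have hL : 1 ≤ L := by omega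
  -- the lifted plane field at the origin: measurable, bounded, an observable of the slab `0 ≤ t ≤ 1`
  set F : GaugeConfig 4 (2 * L + 1) G → ℝ := fun U => plane G r q 0 (torusLift (2 * L + 1) U) with hF
  obtain ⟨C, hC⟩ := exists_abs_plane_le (G := G) r
  have hFm : Measurable F := ((continuous_plane r q 0).comp (continuous_torusLift _)).measurable
  have hFb : ∃ K : ℝ, ∀ U, |F U| ≤ K := ⟨C, fun U => hC q 0 _⟩
  have hFdep : DependsOn F (slab (d := 4) (L := 2 * L + 1) 0 1) := dependsOn_slab_plane_zero G r hL hq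
  -- the on-axis covariance as a sequence
  set c : ℕ → ℝ := fun s => torusE G r β L (fun U => (plane G r q (Pi.single 0 (s : ℤ)) U -
      torusE G r β L (plane G r q (Pi.single 0 (s : ℤ)))) * (plane G r q 0 U - torusE G r β L (plane G r q 0))) with hc
  have hsymm : c L = c (L + 1) := by
    have h := cov_axis_symm G r β L q (s := L) (by omega)
    rw [show 2 * L + 1 - L = L + 1 by omega] at h
    exact h
  -- positivity and log-convexity of the mirror sequence `n ↦ q_F(n)` for `2 + n ≤ 2L`, `2 + n + 2 ≤ 2L`
  have hnn : ∀ n, n + 2 ≤ 2 * L → 0 ≤ mirrorSeq r.ρ β F n := fun n hn =>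
    mirrorSeq_nonneg r.ρ (S := L) rfl hL r.continuous hβ hFm hFb hFdep (T := 1) (by omega)
  have hlc : ∀ n, n + 4 ≤ 2 * L → mirrorSeq r.ρ β F (n + 1) ^ 2 ≤ mirrorSeq r.ρ β F n * mirrorSeq r.ρ β F (n + 2) :=
    fun n hn => mirrorSeq_logConvex r.ρ (S := L) rfl hL r.continuous hβ hFm hFb hFdep (T := 1) (by omega)
  change 0 ≤ c (t + 1) ∧ c (t + 1) ≤ c t
  by_cases hq0 : q.1 = 0
  · -- ELECTRIC plane: `q_F(n) = c(n+1)`; apply §1 to `b(m) = c(m+1)` with top index `M = L − 1` at `m = t − 1`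
    have hb : ∀ n, mirrorSeq r.ρ β F n = c (n + 1) := fun n => by
      rw [hF, mirrorSeq_plane_eq_of_eq G r β L hq hq0 n]
    obtain ⟨M, rfl⟩ : ∃ M, L = M + 1 := ⟨L - 1, by omega⟩
    obtain ⟨s, rfl⟩ : ∃ s, t = s + 1 := ⟨t - 1, by omega⟩
    have key := step_le_of_logConvex (fun m => c (m + 1)) M
      (fun n hn => by have := hnn n (by omega); rwa [hb] at this)
      (fun n hn => by have := hlc n (by omega); simp only [hb] at this; exact this)
      (by show c (M + 1 + 1) ≤ c (M + 1); exact le_of_eq hsymm.symm) s (by omega)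
    refine ⟨?_, by simpa only [add_assoc] using key⟩
    have := hnn (s + 1) (by omega); rwa [hb] at this
  · -- MAGNETIC plane: `q_F(n) = c(n)`; apply §1 with top index `M = L` at `t`
    have hb : ∀ n, mirrorSeq r.ρ β F n = c n := fun n => by
      rw [hF, mirrorSeq_plane_eq_of_ne G r β L hq hq0 n]
    have key := step_le_of_logConvex c L
      (fun n hn => by have := hnn n (by omega); rwa [hb] at this)
      (fun n hn => by have := hlc n (by omega); simp only [hb] at this; exact this)
      (le_of_eq hsymm.symm) t (by omega)
    refine ⟨?_, key⟩
    have := hnn (t + 1) (by omega); rwa [hb] at this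

/-! ## §6 The item: every axis, by hypercubic invariance -/

/-- **`MirrorMonotoneDecay` (stmt-QuantumFields-27771) PROVED**: for SU(2)-class `G`, any lattice representation `r`, `β ≥ 0`, the odd
torus `(ℤ/(2L+1))⁴`, orientation `q.1 < q.2`, axis `k` and `2 ≤ t`, `t + 1 ≤ L`, the centred on-axis mirror covariance satisfies
`0 ≤ c_L(t+1) ≤ c_L(t)` — the axis is moved to the time axis by a coordinate permutation (`MirrorDomination.cov_coordPerm`) and
§5 applies to the re-sorted plane.  (The SU(2) hypotheses of the item are not used: the statement holds for every compact `G`.)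
[cite: OsterwalderSeiler1978, §2; Luscher1977; corpus:book:montvay1994-quantum-fields-lattice p.70] -/
theorem mirrorMonotoneDecay_proof : Summit.QuantumFields.YangMills.Theses.ThermodynamicCeilings.MirrorMonotoneDecay := by
  intro G _ _ _ _ _hG _hiso r β L q k t hβ hq ht htL
  letI : MeasurableSpace G := borel G
  haveI : BorelSpace G := ⟨rfl⟩
  -- move the axis `k` to the time axis
  set π : Equiv.Perm (Fin 4) := Equiv.swap 0 k with hπ
  have hx : ∀ s : ℕ, (fun i : Fin 4 => (fun i : Fin 4 => if i = k then (s : ℤ) else 0) (π.symm i)) =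
      (Pi.single 0 (s : ℤ) : Site 4) := fun s => by
    funext i
    simp only [hπ, Equiv.symm_swap, Pi.single_apply, Equiv.swap_apply_eq_iff, Equiv.swap_apply_right]
  have h0 : (fun i : Fin 4 => (fun _ : Fin 4 => (0 : ℤ)) (π.symm i)) = (0 : Site 4) := by funext i; rfl
  have hperm : ∀ s : ℕ, torusE G r β L (fun U =>
      (plane G r q (fun i => if i = k then (s : ℤ) else 0) U - torusE G r β L (plane G r q (fun i => if i = k then (s : ℤ) else 0))) *
        (plane G r q (fun _ => 0) U - torusE G r β L (plane G r q (fun _ => 0)))) =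
      torusE G r β L (fun U => (plane G r (permPlane π q) (Pi.single 0 (s : ℤ)) U -
          torusE G r β L (plane G r (permPlane π q) (Pi.single 0 (s : ℤ)))) *
        (plane G r (permPlane π q) 0 U - torusE G r β L (plane G r (permPlane π q) 0))) := fun s => by
    rw [← cov_coordPerm G r β L π q q (fun i => if i = k then (s : ℤ) else 0) (fun _ => 0), hx s, h0]
  have key := mirrorMonotoneDecay_axis0 G r hβ (permPlane_valid π hq) ht htL
  rw [hperm (t + 1), hperm t]
  exact key

end Summit.QuantumFields.YangMills.Theorems.MirrorMonotoneDecay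

end
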